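import Literature.NumberTheory.Automorphic.NormGroupClosedProofs
import Literature.NumberTheory.Automorphic.ClassFieldCharacterLocal
import Literature.NumberTheory.Automorphic.QuaternionicFormsClassNumber
import Literature.NumberTheory.Automorphic.AdelicSecondCountable
import Literature.NumberTheory.Automorphic.AdicCompletionCompact
import Mathlib.Topology.Algebra.Group.OpenMapping
import Mathlib.Topology.Algebra.Module.FiniteDimension
import Mathlib.RingTheory.Trace.Basic
import HarnessLib

/-!
# Galois descent for adeles and ideles, and the idelic norm `N_{E/F} : 𝕀_E → 𝕀_F`

Topic `NumberTheory/Automorphic` (infrastructure for base change, Arthur–Clozel Ch. 3 §1: Def. 1.1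
and the norm `N : 𝔸_E^* → 𝔸^*`; rank-one base change `χ ↦ χ ∘ N_{E/F}`); namespace
`Literature.NumberTheory.Automorphic`. Everything here is **proved**; no named facts, no instances.

The sibling files `AdeleBaseChange` (`𝔸_F → 𝔸_E`), `GaloisActionAdeleRing` (`Gal(E/F)` acting on
`𝔸_E`), `ClassFieldCharacter` (the Galois norm `∏_σ σ • y` *kept inside* `𝕀_E`) and
`NormGroupClosedProofs` (whose docstring records that "the tree keeps the norm inside `𝕀_L` … so
instead of `N_{L|K} : C_L → C_K` we use the induced endomorphism") lacked the **descent statement**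
`𝔸_E^{Gal(E/F)} = 𝔸_F`. This file proves it and builds the genuine norm map.

* `isClosedEmbedding_adicCompletionOfLiesOver`, `isClosedEmbedding_completionMap` — the local maps
  `F_v → E_w` are closed embeddings (finite `w`: an injective `F_v`-linear map out of the
  one-dimensional space `F_v`, Mathlib `LinearMap.isClosedEmbedding_of_injective`; infinite `w`: an
  isometry, `norm_completionMap`).
* `isClosed_range_finiteAdeleRing_baseChange`, `isClosed_range_infiniteAdeleRing_baseChange`,
  `isClosed_range_adeleRing_baseChange` — **the base change `𝔸_F → 𝔸_E` has closed range**: the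
  range is the set of adeles whose coordinates above each place `v` of `F` come from one common
  `y_v ∈ F_v` (`isClosed_setOf_exists_forall_eq`; the restricted-product condition is automatic).
* `AdeleRing.mem_range_baseChange_iff`, `AdeleRing.mem_range_ideleBaseChange_iff` — **Galois
  descent `𝔸_E^{Gal(E/F)} = 𝔸_F`, `𝕀_E^{Gal(E/F)} = 𝕀_F`** for `E/F` finite Galois: `E × E` is dense in
  `E_∞ × 𝔸_E^∞` (Mathlib `InfiniteAdeleRing.denseRange_algebraMap`, the tree's
  `denseRange_algebraMap_finiteAdeleRing`), the continuous averaging `T x = ∑_σ σ • x` maps it into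
  the closed range of the base change (`∑_σ σ e = Tr_{E/F} e`, Mathlib `trace_eq_sum_automorphisms`),
  and `T a = #Gal(E/F) • a` on fixed points.
* `AdeleRing.ideleRelNorm F E : 𝕀_E →* 𝕀_F` — **the idelic norm `N_{E/F}`** (`(N y)_E = ∏_σ σ • y`,
  `ideleBaseChange_ideleRelNorm`, `ideleRelNorm_eq_iff`), with `N(x_E) = x ^ [E:F]`
  (`ideleRelNorm_ideleBaseChange`), `N(σ y) = N y`, **continuity** (`continuous_ideleRelNorm`: the
  base change is a homeomorphism onto its closed range by the open mapping theorem for the σ-compact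
  group `𝕀_F`, Mathlib `MonoidHom.isOpenMap_of_sigmaCompact`; `ideleBaseChangeHomeomorph`),
  **`N(Eˣ) ⊆ Fˣ`** (`ideleRelNorm_mem_principalIdeles`), `z_F(t)_E = z_E(t)` and
  `N(z_E(t)) = z_F(t^{[E:F]})` for the positive real ideles (`ideleBaseChange_posRealIdele`,
  `ideleRelNorm_posRealIdele`), and the local computation `N(⟨u⟩_{w₀}) = ⟨u⟩_v^{e_v f_v}` for
  `u ∈ F_vˣ` (`ideleRelNorm_localUnits`, from `ideleGalNorm_localUnits`).

Classical statements: Cassels–Fröhlich, Ch. II (Cassels) §14 (`𝔸_L = 𝔸_K ⊗_K L`, so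
`𝔸_L^G = 𝔸_K`), Ch. VII (Tate) §1–§2 (the norm on ideles and idele classes), §6; Weil, *Basic Number
Theory*, Ch. IV §1. The tensor-product description itself is neither needed nor proved.

## References

* J. W. S. Cassels, A. Fröhlich (eds.), *Algebraic Number Theory* (1967), Ch. II §11, §14, Ch. VII
  §1–§2, §6. [CasselsFrohlichANT1967]
* J. Arthur, L. Clozel, *Simple algebras, base change, and the advanced theory of the trace
  formula*, Ann. of Math. Stud. 120 (1989), Ch. 3, §1 and §4. [ArthurClozelAMS120]
-/

noncomputable section

open NumberField IsDedekindDomain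
open scoped Valued

namespace Literature.NumberTheory.Automorphic

/-! ### The local base-change maps are closed embeddings -/

section LocalClosedEmbedding

variable (F E : Type) [Field F] [Field E] [Algebra F E] [NumberField F] [NumberField E]

/-- **`F_v → E_w` is a closed embedding** (`w ∣ v` finite): it is an injective `F_v`-linear map out
of the one-dimensional `F_v`-space `F_v` into the Hausdorff topological `F_v`-vector space `E_w`
(`F_v` a complete nontrivially normed field), Mathlib `LinearMap.isClosedEmbedding_of_injective`.
[folklore] -/
theorem isClosedEmbedding_adicCompletionOfLiesOver (v : HeightOneSpectrum (𝓞 F))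
    (w : HeightOneSpectrum (𝓞 E)) [w.asIdeal.LiesOver v.asIdeal] :
    Topology.IsClosedEmbedding (adicCompletionOfLiesOver F E v w) := by
  letI : Algebra (v.adicCompletion F) (w.adicCompletion E) :=
    (adicCompletionOfLiesOver F E v w).toAlgebra
  haveI : ContinuousSMul (v.adicCompletion F) (w.adicCompletion E) := ⟨by
    simp only [Algebra.smul_def, RingHom.algebraMap_toAlgebra]
    exact ((continuous_adicCompletionOfLiesOver F E v w).comp continuous_fst).mul continuous_snd⟩
  have h := LinearMap.isClosedEmbedding_of_injective (𝕜 := v.adicCompletion F)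
    (f := Algebra.linearMap (v.adicCompletion F) (w.adicCompletion E))
    (LinearMap.ker_eq_bot.2 (adicCompletionOfLiesOver F E v w).injective)
  exact h

omit [NumberField F] [NumberField E] in
/-- **`F_v → E_w` is norm-preserving** at an infinite place `w ∣ v` (`‖y‖_w = ‖y‖_v`: both sides
are continuous in `y` and agree on the dense `F`, where it is `w(x) = v(x)`). [folklore] -/
theorem norm_infiniteCompletionOfComap (w : InfinitePlace E)
    (y : (w.comap (algebraMap F E)).Completion) :
    ‖infiniteCompletionOfComap F E w y‖ = ‖y‖ := by
  refine congrFun (InfinitePlace.Completion.ext_of_coe (w.comap (algebraMap F E))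
    (continuous_norm.comp (continuous_infiniteCompletionOfComap F E w)) continuous_norm
    fun x => ?_) y
  simp only [Function.comp_apply]
  rw [infiniteCompletionOfComap_coe, InfinitePlace.Completion.norm_coe,
    InfinitePlace.Completion.norm_coe, InfinitePlace.comap_apply]
  rfl

omit [NumberField F] [NumberField E] in
/-- **`F_v → E_w` is a closed embedding** at an infinite place (an isometry out of a complete space).
[folklore] -/
theorem isClosedEmbedding_infiniteCompletionOfComap (w : InfinitePlace E) :
    Topology.IsClosedEmbedding (infiniteCompletionOfComap F E w) :=
  (AddMonoidHomClass.isometry_of_norm (infiniteCompletionOfComap F E w)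
    (norm_infiniteCompletionOfComap F E w)).isClosedEmbedding


omit [NumberField F] [NumberField E] in
/-- Mathlib's `completionMap : F_v → E_w` (any `LiesOver` witness at an infinite place) is
norm-preserving. [folklore] -/
theorem norm_completionMap (v : InfinitePlace F) (w : InfinitePlace E) [w.1.LiesOver v.1]
    (y : v.Completion) : ‖NumberField.LiesOver.completionMap (v := v) (w := w) y‖ = ‖y‖ := by
  refine congrFun (InfinitePlace.Completion.ext_of_coe v
    (continuous_norm.comp NumberField.LiesOver.continuous_completionMap) continuous_norm
    fun x => ?_) y
  simp only [Function.comp_apply]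
  change ‖NumberField.LiesOver.completionMap ((WithAbs.toAbs v.1 x : WithAbs v.1) : v.Completion)‖ =
    ‖((WithAbs.toAbs v.1 x : WithAbs v.1) : v.Completion)‖
  rw [NumberField.LiesOver.completionMap_coe, InfinitePlace.Completion.norm_coe,
    InfinitePlace.Completion.norm_coe]
  change w (algebraMap F E x) = v x
  rw [← InfinitePlace.comap_apply, NumberField.InfinitePlace.LiesOver.comap_eq w v]

omit [NumberField F] [NumberField E] in
/-- `completionMap : F_v → E_w` is a closed embedding (any `LiesOver` witness). [folklore] -/
theorem isClosedEmbedding_completionMap (v : InfinitePlace F) (w : InfinitePlace E)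
    [w.1.LiesOver v.1] :
    Topology.IsClosedEmbedding (NumberField.LiesOver.completionMap (v := v) (w := w)) :=
  (AddMonoidHomClass.isometry_of_norm (NumberField.LiesOver.completionMap (v := v) (w := w))
    (norm_completionMap F E v w)).isClosedEmbedding

end LocalClosedEmbedding

/-! ### The base change of adeles has closed range -/

section ClosedRange

variable (F E : Type) [Field F] [Field E] [Algebra F E] [NumberField F] [NumberField E]

/-- A set of the form `{a | ∃ y, ∀ i (hi : p i), a i = ι i hi y}` — "the coordinates in the fibre
`{i | p i}` come from one common `y` through closed embeddings `ι i hi`" — is closed in a product-like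
space with continuous coordinate maps, provided the fibre is non-empty. Auxiliary topological lemma
(the coordinate at a chosen `i₀` determines `y` continuously). [folklore] -/
theorem isClosed_setOf_exists_forall_eq {A X : Type*} [TopologicalSpace A] [TopologicalSpace X]
    {ι' : Type*} {Y : ι' → Type*} [∀ i, TopologicalSpace (Y i)] [∀ i, T2Space (Y i)]
    (p : ι' → Prop) (coord : ∀ i, A → Y i) (hcoord : ∀ i, Continuous (coord i))
    (emb : ∀ i, p i → X → Y i) (hemb : ∀ i (hi : p i), Topology.IsClosedEmbedding (emb i hi))
    {i₀ : ι'} (hi₀ : p i₀) :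
    IsClosed {a : A | ∃ y : X, ∀ i (hi : p i), coord i a = emb i hi y} := by
  have hE := hemb i₀ hi₀
  -- the closed set where the `i₀`-coordinate lies in the range of `emb i₀ hi₀`
  set S : Set A := (coord i₀) ⁻¹' Set.range (emb i₀ hi₀) with hS
  have hSc : IsClosed S := hE.isClosed_range.preimage (hcoord i₀)
  -- on `S`, the parameter `y` is a continuous function of `a`
  set g : S → X := fun s => hE.isEmbedding.toHomeomorph.symm ⟨coord i₀ s.1, s.2⟩ with hg
  have hgc : Continuous g :=
    hE.isEmbedding.toHomeomorph.symm.continuous.comp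
      (((hcoord i₀).comp continuous_subtype_val).subtype_mk _)
  have hge : ∀ s : S, emb i₀ hi₀ (g s) = coord i₀ s.1 := fun s => by
    have h1 := congrArg Subtype.val
      (hE.isEmbedding.toHomeomorph.apply_symm_apply ⟨coord i₀ s.1, s.2⟩)
    rw [Topology.IsEmbedding.toHomeomorph_apply_coe] at h1
    exact h1
  set D : Set S := {s | ∀ i (hi : p i), coord i s.1 = emb i hi (g s)} with hD
  have hDc : IsClosed D := by
    have : D = ⋂ i, ⋂ hi : p i, {s : S | coord i s.1 = emb i hi (g s)} := by
      ext s; simp [hD]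
    rw [this]
    exact isClosed_iInter fun i => isClosed_iInter fun hi =>
      isClosed_eq ((hcoord i).comp continuous_subtype_val) ((hemb i hi).continuous.comp hgc)
  have hset : {a : A | ∃ y : X, ∀ i (hi : p i), coord i a = emb i hi y} = Subtype.val '' D := by
    ext a
    constructor
    · rintro ⟨y, hy⟩
      have ha : a ∈ S := ⟨y, (hy i₀ hi₀).symm⟩
      refine ⟨⟨a, ha⟩, ?_, rfl⟩
      have hgy : g ⟨a, ha⟩ = y := hE.injective (by rw [hge]; exact hy i₀ hi₀)
      intro i hi
      rw [hgy]
      exact hy i hi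
    · rintro ⟨s, hs, rfl⟩
      exact ⟨g s, hs⟩
  rw [hset]
  exact hSc.isClosedMap_subtype_val _ hDc

/-- **The base change of finite adeles `𝔸_F^∞ → 𝔸_E^∞` has closed range.** Its range is the set of
finite adeles of `E` whose coordinates above each finite place `v` of `F` come from one common
`y_v ∈ F_v` (the restricted-product condition on `(y_v)_v` is automatic, as `y_v ∈ 𝒪_v` iff its
image lies in `𝒪_w`), an intersection of closed sets by `isClosed_setOf_exists_forall_eq`. [folklore] -/
theorem isClosed_range_finiteAdeleRing_baseChange :
    IsClosed (Set.range (FiniteAdeleRing.baseChange (𝓞 F) F E (𝓞 E))) := by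
  -- description of the range
  have hrange : Set.range (FiniteAdeleRing.baseChange (𝓞 F) F E (𝓞 E)) =
      ⋂ v : HeightOneSpectrum (𝓞 F), {a : FiniteAdeleRing (𝓞 E) E | ∃ y : v.adicCompletion F,
        ∀ (w : HeightOneSpectrum (𝓞 E)) (hw : w.asIdeal.LiesOver v.asIdeal),
          a w = adicCompletionOfLiesOver F E v w y} := by
    ext a
    simp only [Set.mem_iInter, Set.mem_setOf_eq, Set.mem_range]
    constructor
    · rintro ⟨x, rfl⟩ v
      refine ⟨x v, fun w hw => ?_⟩
      have hv : w.under (𝓞 F) = v := HeightOneSpectrum.ext hw.over.symm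
      rw [FiniteAdeleRing.baseChange_apply]
      exact adicCompletionOfUnder_eq F w hv (⇑x)
    · intro h
      choose y hy using h
      have hint : ∀ᶠ v : HeightOneSpectrum (𝓞 F) in Filter.cofinite,
          y v ∈ (v.adicCompletionIntegers F : Set (v.adicCompletion F)) := by
        have ha : ∀ᶠ w : HeightOneSpectrum (𝓞 E) in Filter.cofinite,
            a w ∈ (w.adicCompletionIntegers E : Set (w.adicCompletion E)) := a.2
        rw [Filter.eventually_cofinite] at ha ⊢
        refine (ha.image fun w => w.under (𝓞 F)).subset fun v hv => ?_
        obtain ⟨w, hwv⟩ := HeightOneSpectrum.under_surjective (A := 𝓞 F) (B := 𝓞 E) v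
        refine ⟨w, ?_, hwv⟩
        haveI : w.asIdeal.LiesOver v.asIdeal := ⟨(congrArg HeightOneSpectrum.asIdeal hwv).symm⟩
        intro hw
        apply hv
        rw [hy v w inferInstance] at hw
        rw [SetLike.mem_coe, HeightOneSpectrum.mem_adicCompletionIntegers] at hw ⊢
        rw [valued_adicCompletionOfLiesOver] at hw
        by_contra h1
        push Not at h1
        exact not_lt.2 hw (one_lt_pow₀ h1
          (Ideal.IsDedekindDomain.ramificationIdx'_ne_zero_of_liesOver w.asIdeal v.ne_bot))
      refine ⟨⟨fun v => y v, hint⟩, FiniteAdeleRing.ext E fun w => ?_⟩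
      rw [FiniteAdeleRing.baseChange_apply]
      exact (hy (w.under (𝓞 F)) w ⟨rfl⟩).symm
  rw [hrange]
  refine isClosed_iInter fun v => ?_
  obtain ⟨w₀, hw₀⟩ := HeightOneSpectrum.under_surjective (A := 𝓞 F) (B := 𝓞 E) v
  haveI i₀ : w₀.asIdeal.LiesOver v.asIdeal := ⟨(congrArg HeightOneSpectrum.asIdeal hw₀).symm⟩
  exact isClosed_setOf_exists_forall_eq (Y := fun w : HeightOneSpectrum (𝓞 E) => w.adicCompletion E)
    (fun w : HeightOneSpectrum (𝓞 E) => w.asIdeal.LiesOver v.asIdeal)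
    (fun w (a : FiniteAdeleRing (𝓞 E) E) => a w) (fun w => RestrictedProduct.continuous_eval w)
    (fun w hw => @adicCompletionOfLiesOver (𝓞 F) F E (𝓞 E) _ _ _ _ _ _ _ _ _ _ _ _ _ _ _ _ v w hw)
    (fun w hw => @isClosedEmbedding_adicCompletionOfLiesOver F E _ _ _ _ _ v w hw) i₀

/-- **The base change of infinite adeles `F_∞ → E_∞` has closed range** (same argument, no
restricted-product condition). [folklore] -/
theorem isClosed_range_infiniteAdeleRing_baseChange :
    IsClosed (Set.range (InfiniteAdeleRing.baseChange F E)) := by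
  have hrange : Set.range (InfiniteAdeleRing.baseChange F E) =
      ⋂ v : InfinitePlace F, {a : InfiniteAdeleRing E | ∃ y : v.Completion,
        ∀ (w : InfinitePlace E) (hw : w.1.LiesOver v.1),
          a w = NumberField.LiesOver.completionMap (v := v) (w := w) y} := by
    ext a
    simp only [Set.mem_iInter, Set.mem_setOf_eq, Set.mem_range]
    constructor
    · rintro ⟨x, rfl⟩ v
      refine ⟨x v, fun w hw => ?_⟩
      rw [InfiniteAdeleRing.baseChange_apply]
      exact infiniteCompletionOfComap_eq F w (NumberField.InfinitePlace.LiesOver.comap_eq w v) x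
    · intro h
      choose y hy using h
      refine ⟨fun v => y v, funext fun w => ?_⟩
      rw [InfiniteAdeleRing.baseChange_apply]
      haveI : w.1.LiesOver (w.comap (algebraMap F E)).1 := ⟨rfl⟩
      exact (hy (w.comap (algebraMap F E)) w inferInstance).symm
  rw [hrange]
  refine isClosed_iInter fun v => ?_
  obtain ⟨w₀, hw₀⟩ := InfinitePlace.comap_surjective (k := F) (K := E) v
  haveI i₀ : w₀.1.LiesOver v.1 := ⟨congrArg Subtype.val hw₀⟩
  exact isClosed_setOf_exists_forall_eq (Y := fun w : InfinitePlace E => w.Completion)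
    (fun w : InfinitePlace E => w.1.LiesOver v.1)
    (fun w (a : InfiniteAdeleRing E) => a w) (fun w => continuous_apply w)
    (fun w hw => @NumberField.LiesOver.completionMap F E _ _ _ v w hw)
    (fun w hw => @isClosedEmbedding_completionMap F E _ _ _ v w hw) i₀

/-- **The base change of adeles `𝔸_F → 𝔸_E` has closed range.** [folklore] -/
theorem isClosed_range_adeleRing_baseChange :
    IsClosed (Set.range (AdeleRing.baseChange F E)) := by
  have : Set.range (AdeleRing.baseChange F E) =
      Set.range (InfiniteAdeleRing.baseChange F E) ×ˢ
        Set.range (FiniteAdeleRing.baseChange (𝓞 F) F E (𝓞 E)) := by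
    ext a
    constructor
    · rintro ⟨x, rfl⟩
      exact ⟨⟨x.1, rfl⟩, ⟨x.2, rfl⟩⟩
    · rintro ⟨⟨x₁, h₁⟩, ⟨x₂, h₂⟩⟩
      exact ⟨(x₁, x₂), Prod.ext h₁ h₂⟩
  rw [this]
  exact (isClosed_range_infiniteAdeleRing_baseChange F E).prod
    (isClosed_range_finiteAdeleRing_baseChange F E)

end ClosedRange

/-! ### Galois descent: `𝔸_E^{Gal(E/F)} = 𝔸_F` and `𝕀_E^{Gal(E/F)} = 𝕀_F` -/

section Descent

variable (F E : Type) [Field F] [Field E] [Algebra F E] [NumberField F] [NumberField E]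

/-- The averaging operator `T x = ∑_σ σ • x` maps the diagonal image of `E × E` in
`𝔸_E = E_∞ × 𝔸_E^∞` into the range of the base change: `T (e₁, e₂) = (Tr e₁, Tr e₂)_{𝔸_F}` viewed in
`𝔸_E` (`E/F` Galois: `∑_σ σ e = Tr_{E/F} e`, Mathlib `trace_eq_sum_automorphisms`). [folklore] -/
theorem AdeleRing.sum_smul_algebraMap_mem_range_baseChange [IsGalois F E] (e₁ e₂ : E) :
    (∑ σ : E ≃ₐ[F] E, σ • ((algebraMap E (InfiniteAdeleRing E) e₁,
        algebraMap E (FiniteAdeleRing (𝓞 E) E) e₂) : AdeleRing (𝓞 E) E)) ∈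
      Set.range (AdeleRing.baseChange F E) := by
  haveI : FiniteDimensional F E := Module.Finite.of_restrictScalars_finite ℚ F E
  refine ⟨(algebraMap F (InfiniteAdeleRing F) (Algebra.trace F E e₁),
    algebraMap F (FiniteAdeleRing (𝓞 F) F) (Algebra.trace F E e₂)), ?_⟩
  simp_rw [AdeleRing.smul_mk]
  refine Prod.ext ?_ ?_
  · rw [AdeleRing.baseChange_fst, Prod.fst_sum, InfiniteAdeleRing.baseChange_algebraMap,
      trace_eq_sum_automorphisms, map_sum]
    exact Finset.sum_congr rfl fun σ _ => (InfiniteAdeleRing.smul_algebraMap F σ e₁).symm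
  · rw [AdeleRing.baseChange_snd, Prod.snd_sum, FiniteAdeleRing.baseChange_algebraMap,
      trace_eq_sum_automorphisms, map_sum]
    exact Finset.sum_congr rfl fun σ _ => (FiniteAdeleRing.smul_algebraMap (B := 𝓞 E) E σ e₂).symm

/-- **Galois descent for adeles.** For a finite Galois extension `E/F` of number fields, an adele
of `E` fixed by every `σ ∈ Gal(E/F)` is the base change of an adele of `F`: `𝔸_E^{Gal(E/F)} = 𝔸_F`
(Cassels–Fröhlich, Ch. II §14 with Ch. VII §1: `𝔸_E = 𝔸_F ⊗_F E` and `(L ⊗ K_v)^G = K_v`). Proof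
without the tensor description: `E × E` is dense in `E_∞ × 𝔸_E^∞` (weak and strong approximation,
Mathlib `InfiniteAdeleRing.denseRange_algebraMap` and `denseRange_algebraMap_finiteAdeleRing`), the
continuous averaging `T x = ∑_σ σ • x` maps it into the *closed* range of the base change
(`sum_smul_algebraMap_mem_range_baseChange`, `isClosed_range_adeleRing_baseChange`), and
`T a = |Gal(E/F)| • a` for a fixed `a`; divide by `|Gal(E/F)|`.
[cite: CasselsFrohlichANT1967, Ch. II §14] -/
theorem AdeleRing.mem_range_baseChange_of_forall_smul_eq [IsGalois F E] {a : AdeleRing (𝓞 E) E}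
    (ha : ∀ σ : E ≃ₐ[F] E, σ • a = a) : a ∈ Set.range (AdeleRing.baseChange F E) := by
  classical
  -- the averaging operator
  set T : AdeleRing (𝓞 E) E → AdeleRing (𝓞 E) E := fun x => ∑ σ : E ≃ₐ[F] E, σ • x with hT
  have hTc : Continuous T := by
    rw [hT]
    exact continuous_finsetSum _ fun σ _ => AdeleRing.continuous_smul F σ
  have hTa : T a = (Fintype.card (E ≃ₐ[F] E) : AdeleRing (𝓞 E) E) * a := by
    simp only [hT, ha, Finset.sum_const, Finset.card_univ, nsmul_eq_mul]
  -- density of `E × E` and the closed range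
  have hdense : DenseRange (Prod.map (algebraMap E (InfiniteAdeleRing E))
      (algebraMap E (FiniteAdeleRing (𝓞 E) E))) :=
    (InfiniteAdeleRing.denseRange_algebraMap (K := E)).prodMap
      (denseRange_algebraMap_finiteAdeleRing (𝓞 E) E)
  have hsub : T '' Set.range (Prod.map (algebraMap E (InfiniteAdeleRing E))
      (algebraMap E (FiniteAdeleRing (𝓞 E) E))) ⊆ Set.range (AdeleRing.baseChange F E) := by
    rintro _ ⟨_, ⟨p, rfl⟩, rfl⟩
    exact AdeleRing.sum_smul_algebraMap_mem_range_baseChange F E p.1 p.2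
  have hTa_mem : T a ∈ Set.range (AdeleRing.baseChange F E) := by
    have h1 : T a ∈ closure (T '' Set.range (Prod.map (algebraMap E (InfiniteAdeleRing E))
        (algebraMap E (FiniteAdeleRing (𝓞 E) E)))) :=
      image_closure_subset_closure_image hTc ⟨a, hdense.closure_range.symm ▸ Set.mem_univ a, rfl⟩
    exact (isClosed_range_adeleRing_baseChange F E).closure_subset_iff.mpr hsub h1
  -- divide by the degree
  obtain ⟨b, hb⟩ := hTa_mem
  rw [hTa] at hb
  set d : ℕ := Fintype.card (E ≃ₐ[F] E) with hd
  have hdE : (d : E) ≠ 0 := by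
    rw [hd]
    exact_mod_cast Fintype.card_ne_zero
  refine ⟨algebraMap F (AdeleRing (𝓞 F) F) ((d : F)⁻¹) * b, ?_⟩
  rw [map_mul, hb, AdeleRing.baseChange_algebraMap, map_inv₀ (algebraMap F E), map_natCast,
    ← map_natCast (algebraMap E (AdeleRing (𝓞 E) E)) d, ← mul_assoc, ← map_mul,
    inv_mul_cancel₀ hdE, map_one, one_mul]

/-- **`𝔸_E^{Gal(E/F)} = 𝔸_F`**: an adele of `E` is fixed by `Gal(E/F)` iff it is the base change of an
adele of `F` (`E/F` finite Galois). [cite: CasselsFrohlichANT1967, Ch. II §14] -/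
theorem AdeleRing.mem_range_baseChange_iff [IsGalois F E] (a : AdeleRing (𝓞 E) E) :
    a ∈ Set.range (AdeleRing.baseChange F E) ↔ ∀ σ : E ≃ₐ[F] E, σ • a = a := by
  refine ⟨?_, AdeleRing.mem_range_baseChange_of_forall_smul_eq F E⟩
  rintro ⟨b, rfl⟩ σ
  exact AdeleRing.smul_baseChange F E σ b

/-- **Galois descent for ideles: `𝕀_E^{Gal(E/F)} = 𝕀_F`.** An idele of `E` fixed by `Gal(E/F)` is
the base change of an idele of `F` (apply the adelic statement to `y` and `y⁻¹`; the base change is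
injective). [cite: CasselsFrohlichANT1967, Ch. II §14] -/
theorem AdeleRing.mem_range_ideleBaseChange_of_forall_smul_eq [IsGalois F E]
    {y : (AdeleRing (𝓞 E) E)ˣ} (hy : ∀ σ : E ≃ₐ[F] E, σ • y = y) :
    y ∈ Set.range (AdeleRing.ideleBaseChange F E) := by
  have h1 : ∀ σ : E ≃ₐ[F] E, σ • (y : AdeleRing (𝓞 E) E) = y := fun σ => by
    rw [← AdeleRing.coe_smul_units, hy σ]
  have h2 : ∀ σ : E ≃ₐ[F] E, σ • ((y⁻¹ : (AdeleRing (𝓞 E) E)ˣ) : AdeleRing (𝓞 E) E) = ↑y⁻¹ :=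
    fun σ => by rw [← AdeleRing.coe_smul_units, smul_inv', hy σ]
  obtain ⟨b, hb⟩ := AdeleRing.mem_range_baseChange_of_forall_smul_eq F E h1
  obtain ⟨b', hb'⟩ := AdeleRing.mem_range_baseChange_of_forall_smul_eq F E h2
  have hbb' : b * b' = 1 := AdeleRing.baseChange_injective F E (by
    rw [map_mul, hb, hb', map_one, Units.mul_inv])
  refine ⟨⟨b, b', hbb', by rw [mul_comm]; exact hbb'⟩, Units.ext ?_⟩
  rw [AdeleRing.coe_ideleBaseChange]
  exact hb

/-- **`𝕀_E^{Gal(E/F)} = 𝕀_F`** (iff form). [cite: CasselsFrohlichANT1967, Ch. II §14] -/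
theorem AdeleRing.mem_range_ideleBaseChange_iff [IsGalois F E] (y : (AdeleRing (𝓞 E) E)ˣ) :
    y ∈ Set.range (AdeleRing.ideleBaseChange F E) ↔ ∀ σ : E ≃ₐ[F] E, σ • y = y := by
  refine ⟨?_, AdeleRing.mem_range_ideleBaseChange_of_forall_smul_eq F E⟩
  rintro ⟨x, rfl⟩ σ
  exact AdeleRing.smul_ideleBaseChange F E σ x

/-- The Galois norm `N y = ∏_σ σ • y` of any idele of `E` is the base change of an idele of `F`
(`E/F` Galois; `N y` is `Gal(E/F)`-invariant, `AdeleRing.smul_ideleGalNorm`). [folklore] -/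
theorem AdeleRing.ideleGalNorm_mem_range_ideleBaseChange [IsGalois F E] (y : (AdeleRing (𝓞 E) E)ˣ) :
    AdeleRing.ideleGalNorm F E y ∈ Set.range (AdeleRing.ideleBaseChange F E) :=
  AdeleRing.mem_range_ideleBaseChange_of_forall_smul_eq F E fun σ => AdeleRing.smul_ideleGalNorm F E σ y

end Descent

/-! ### The idelic norm `N_{E/F} : 𝕀_E → 𝕀_F` -/

section RelNorm

variable (F E : Type) [Field F] [Field E] [Algebra F E] [NumberField F] [NumberField E] [IsGalois F E]

/-- **The idelic norm `N_{E/F} : 𝕀_E →* 𝕀_F`** of a finite Galois extension of number fields: the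
unique idele of `F` whose base change to `E` is the Galois norm `∏_{σ ∈ Gal(E/F)} σ • y`
(`AdeleRing.ideleGalNorm`; it descends by `AdeleRing.ideleGalNorm_mem_range_ideleBaseChange`, uniquely
since the base change is injective). Cassels–Fröhlich, Ch. II §11 (local norms) and Ch. VII §1–§2,
§6 (the norm map on ideles and idele classes); Arthur–Clozel, Ch. 3 §1, §4 (`N(𝔸_E^*) ⊆ 𝔸^*`).
[cite: CasselsFrohlichANT1967, Ch. VII §2] -/
def AdeleRing.ideleRelNorm : (AdeleRing (𝓞 E) E)ˣ →* (AdeleRing (𝓞 F) F)ˣ where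
  toFun y := (AdeleRing.ideleGalNorm_mem_range_ideleBaseChange F E y).choose
  map_one' := AdeleRing.ideleBaseChange_injective F E (by
    rw [(AdeleRing.ideleGalNorm_mem_range_ideleBaseChange F E 1).choose_spec, map_one, map_one])
  map_mul' y z := AdeleRing.ideleBaseChange_injective F E (by
    have h1 := (AdeleRing.ideleGalNorm_mem_range_ideleBaseChange F E (y * z)).choose_spec
    have h2 := (AdeleRing.ideleGalNorm_mem_range_ideleBaseChange F E y).choose_spec
    have h3 := (AdeleRing.ideleGalNorm_mem_range_ideleBaseChange F E z).choose_spec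
    rw [h1]
    simp only [map_mul, h2, h3])

/-- Defining property of the idelic norm: `(N_{E/F} y)_E = ∏_σ σ • y`. [folklore] -/
@[simp] theorem AdeleRing.ideleBaseChange_ideleRelNorm (y : (AdeleRing (𝓞 E) E)ˣ) :
    AdeleRing.ideleBaseChange F E (AdeleRing.ideleRelNorm F E y) = AdeleRing.ideleGalNorm F E y :=
  (AdeleRing.ideleGalNorm_mem_range_ideleBaseChange F E y).choose_spec

variable {F E} in
/-- `N_{E/F} y = x ↔ x_E = ∏_σ σ • y`. [folklore] -/
theorem AdeleRing.ideleRelNorm_eq_iff {y : (AdeleRing (𝓞 E) E)ˣ} {x : (AdeleRing (𝓞 F) F)ˣ} :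
    AdeleRing.ideleRelNorm F E y = x ↔
      AdeleRing.ideleBaseChange F E x = AdeleRing.ideleGalNorm F E y := by
  constructor
  · rintro rfl
    exact AdeleRing.ideleBaseChange_ideleRelNorm F E y
  · intro h
    exact AdeleRing.ideleBaseChange_injective F E
      ((AdeleRing.ideleBaseChange_ideleRelNorm F E y).trans h.symm)

/-- **`N_{E/F}(x_E) = x ^ [E : F]`** for an idele `x` of `F` (`#Gal(E/F) = [E : F]`).
[cite: CasselsFrohlichANT1967, Ch. VII §2] -/
theorem AdeleRing.ideleRelNorm_ideleBaseChange (x : (AdeleRing (𝓞 F) F)ˣ) :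
    AdeleRing.ideleRelNorm F E (AdeleRing.ideleBaseChange F E x) = x ^ Fintype.card (E ≃ₐ[F] E) :=
  AdeleRing.ideleRelNorm_eq_iff.2 (by rw [map_pow, AdeleRing.ideleGalNorm_ideleBaseChange])

/-- `N_{E/F}(σ • y) = N_{E/F}(y)`. [folklore] -/
@[simp] theorem AdeleRing.ideleRelNorm_smul (σ : E ≃ₐ[F] E) (y : (AdeleRing (𝓞 E) E)ˣ) :
    AdeleRing.ideleRelNorm F E (σ • y) = AdeleRing.ideleRelNorm F E y :=
  AdeleRing.ideleRelNorm_eq_iff.2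
    (by rw [AdeleRing.ideleBaseChange_ideleRelNorm, AdeleRing.ideleGalNorm_smul])

/-- The range of the base change `𝕀_F → 𝕀_E` is closed (it is the fixed set of `Gal(E/F)`).
[folklore] -/
theorem AdeleRing.isClosed_range_ideleBaseChange :
    IsClosed (Set.range (AdeleRing.ideleBaseChange F E)) := by
  have : Set.range (AdeleRing.ideleBaseChange F E) =
      ⋂ σ : E ≃ₐ[F] E, {y : (AdeleRing (𝓞 E) E)ˣ | σ • y = y} := by
    ext y
    rw [AdeleRing.mem_range_ideleBaseChange_iff, Set.mem_iInter]
    rfl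
  rw [this]
  haveI := t2Space_ideleGroup E
  exact isClosed_iInter fun σ => isClosed_eq (ideleGroup_continuous_smul F E σ) continuous_id

omit [IsGalois F E] in
/-- `𝔸_F` is Hausdorff (Mathlib instances on `F_∞ × 𝔸_F^∞`; restated to keep imports light).
[folklore] -/
theorem AdeleRing.t2Space' : T2Space (AdeleRing (𝓞 F) F) := by
  haveI : T2Space (InfiniteAdeleRing F) :=
    inferInstanceAs (T2Space ((v : InfinitePlace F) → v.Completion))
  haveI : T2Space (FiniteAdeleRing (𝓞 F) F) :=
    inferInstanceAs (T2Space (RestrictedProduct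
      (fun v : HeightOneSpectrum (𝓞 F) => v.adicCompletion F)
      (fun v => (v.adicCompletionIntegers F : Set (v.adicCompletion F))) Filter.cofinite))
  exact inferInstanceAs (T2Space (InfiniteAdeleRing F × FiniteAdeleRing (𝓞 F) F))

omit [IsGalois F E] in
/-- `𝕀_F` is σ-compact (locally compact and second countable: `locallyCompactSpace_adeleRing'`,
`secondCountableTopology_adeleRing`, units topology). [folklore] -/
theorem AdeleRing.sigmaCompactSpace_ideleGroup : SigmaCompactSpace (AdeleRing (𝓞 F) F)ˣ := by
  haveI := locallyCompactSpace_adeleRing' F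
  haveI : T2Space (AdeleRing (𝓞 F) F) := AdeleRing.t2Space' F
  haveI : LocallyCompactSpace (AdeleRing (𝓞 F) F)ˣ := inferInstance
  haveI : SecondCountableTopology (AdeleRing (𝓞 F) F)ˣ := by
    haveI := secondCountableTopology_adeleRing F
    haveI : SecondCountableTopology (AdeleRing (𝓞 F) F)ᵐᵒᵖ :=
      MulOpposite.opHomeomorph.symm.secondCountableTopology
    exact Units.isEmbedding_embedProduct.secondCountableTopology
  infer_instance

/-- **The base change `𝕀_F → (𝕀_F)_E` is a homeomorphism onto its (closed) range**: a continuous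
bijective homomorphism from the σ-compact group `𝕀_F` onto a locally compact Hausdorff group is open
(open mapping theorem, Mathlib `MonoidHom.isOpenMap_of_sigmaCompact`). [folklore] -/
def AdeleRing.ideleBaseChangeHomeomorph :
    (AdeleRing (𝓞 F) F)ˣ ≃ₜ (AdeleRing.ideleBaseChange F E).range := by
  haveI := AdeleRing.sigmaCompactSpace_ideleGroup F
  haveI := locallyCompactSpace_adeleRing' E
  haveI : T2Space (AdeleRing (𝓞 E) E)ˣ := t2Space_ideleGroup E
  haveI : T2Space (AdeleRing (𝓞 E) E) := AdeleRing.t2Space' E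
  haveI : LocallyCompactSpace (AdeleRing (𝓞 E) E)ˣ := inferInstance
  have hRc : IsClosed ((AdeleRing.ideleBaseChange F E).range : Set (AdeleRing (𝓞 E) E)ˣ) := by
    rw [MonoidHom.coe_range]
    exact AdeleRing.isClosed_range_ideleBaseChange F E
  haveI : LocallyCompactSpace (AdeleRing.ideleBaseChange F E).range := hRc.locallyCompactSpace
  let f : (AdeleRing (𝓞 F) F)ˣ →* (AdeleRing.ideleBaseChange F E).range :=
    (AdeleRing.ideleBaseChange F E).rangeRestrict
  have hfc : Continuous f := (continuous_ideleBaseChange F E).subtype_mk _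
  have hfs : Function.Surjective f := MonoidHom.rangeRestrict_surjective _
  have hfi : Function.Injective f := fun x y h =>
    AdeleRing.ideleBaseChange_injective F E (congrArg Subtype.val h)
  have hfo : IsOpenMap f := MonoidHom.isOpenMap_of_sigmaCompact f hfs hfc
  exact (Equiv.ofBijective f ⟨hfi, hfs⟩).toHomeomorphOfContinuousOpen hfc hfo

/-- Underlying map of `ideleBaseChangeHomeomorph` (definitional). [folklore] -/
@[simp] theorem AdeleRing.coe_ideleBaseChangeHomeomorph_apply (x : (AdeleRing (𝓞 F) F)ˣ) :
    ((AdeleRing.ideleBaseChangeHomeomorph F E x : (AdeleRing.ideleBaseChange F E).range) :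
      (AdeleRing (𝓞 E) E)ˣ) = AdeleRing.ideleBaseChange F E x := rfl

/-- `N_{E/F}` through the homeomorphism: `N y = bc⁻¹ (∏_σ σ • y)`. [folklore] -/
theorem AdeleRing.ideleRelNorm_eq_symm_apply (y : (AdeleRing (𝓞 E) E)ˣ) :
    AdeleRing.ideleRelNorm F E y = (AdeleRing.ideleBaseChangeHomeomorph F E).symm
      ⟨AdeleRing.ideleGalNorm F E y,
        MonoidHom.mem_range.2 (AdeleRing.ideleGalNorm_mem_range_ideleBaseChange F E y)⟩ := by
  rw [eq_comm, Homeomorph.symm_apply_eq]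
  exact Subtype.ext (AdeleRing.ideleBaseChange_ideleRelNorm F E y).symm

/-- **The idelic norm `N_{E/F} : 𝕀_E → 𝕀_F` is continuous** (`continuous_ideleGalNorm` and the
homeomorphism `ideleBaseChangeHomeomorph`). [folklore] -/
theorem AdeleRing.continuous_ideleRelNorm : Continuous (AdeleRing.ideleRelNorm F E) := by
  have h : (AdeleRing.ideleRelNorm F E : (AdeleRing (𝓞 E) E)ˣ → (AdeleRing (𝓞 F) F)ˣ) =
      fun y => (AdeleRing.ideleBaseChangeHomeomorph F E).symm
        ⟨AdeleRing.ideleGalNorm F E y,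
          MonoidHom.mem_range.2 (AdeleRing.ideleGalNorm_mem_range_ideleBaseChange F E y)⟩ :=
    funext fun y => AdeleRing.ideleRelNorm_eq_symm_apply F E y
  rw [h]
  exact (AdeleRing.ideleBaseChangeHomeomorph F E).symm.continuous.comp
    ((continuous_ideleGalNorm F E).subtype_mk _)

/-- **`N_{E/F}(Eˣ) ⊆ Fˣ`**: the norm of a principal idele is principal (its Galois norm is a
`Gal(E/F)`-fixed principal idele of `E`, hence comes from `Fˣ`;
`exists_ideleBaseChange_eq_of_forall_smul_eq`). [cite: CasselsFrohlichANT1967, Ch. VII §2] -/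
theorem AdeleRing.ideleRelNorm_mem_principalIdeles {y : (AdeleRing (𝓞 E) E)ˣ}
    (hy : y ∈ GaloisRepresentations.principalIdeles E) :
    AdeleRing.ideleRelNorm F E y ∈ GaloisRepresentations.principalIdeles F := by
  obtain ⟨x, hx, hxy⟩ := exists_ideleBaseChange_eq_of_forall_smul_eq F E
    (ideleGalNorm_mem_principalIdeles F E hy) (fun σ => AdeleRing.smul_ideleGalNorm F E σ y)
  rw [AdeleRing.ideleRelNorm_eq_iff.2 hxy]
  exact hx

omit [IsGalois F E] in
/-- **Base change of the positive real ideles: `z_F(t)_E = z_E(t)`** (diagonal `t` at the infinite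
places, `1` at the finite ones). At an infinite place both `t ↦ (z_F(t)_E)_w` and `t ↦ z_E(t)_w` are
continuous ring homomorphisms `ℝ → E_w` agreeing on `ℚ`. [folklore] -/
theorem AdeleRing.ideleBaseChange_posRealIdele (t : NNRealˣ) :
    AdeleRing.ideleBaseChange F E (posRealIdele F t) = posRealIdele E t := by
  refine Units.ext (Prod.ext ?_ ?_)
  · rw [AdeleRing.coe_ideleBaseChange, AdeleRing.baseChange_fst, posRealIdele_fst, posRealIdele_fst]
    -- `InfiniteAdeleRing.baseChange F E ∘ realToInfiniteAdele F = realToInfiniteAdele E` on `ℝ`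
    have h1 : Continuous fun s : ℝ => InfiniteAdeleRing.baseChange F E (realToInfiniteAdele F s) :=
      (InfiniteAdeleRing.continuous_baseChange F E).comp (continuous_realToInfiniteAdele F)
    have hq : (fun s : ℝ => InfiniteAdeleRing.baseChange F E (realToInfiniteAdele F s)) ∘
        (Rat.cast : ℚ → ℝ) = (realToInfiniteAdele E) ∘ (Rat.cast : ℚ → ℝ) := by
      have := RingHom.ext_rat
        (((InfiniteAdeleRing.baseChange F E).comp (realToInfiniteAdele F)).comp (Rat.castHom ℝ))
        ((realToInfiniteAdele E).comp (Rat.castHom ℝ))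
      exact congrArg (fun f : ℚ →+* InfiniteAdeleRing E => (f : ℚ → InfiniteAdeleRing E)) this
    haveI : T2Space (InfiniteAdeleRing E) :=
      inferInstanceAs (T2Space ((v : InfinitePlace E) → v.Completion))
    exact congrFun (Rat.denseRange_cast.equalizer h1 (continuous_realToInfiniteAdele E) hq) _
  · rw [AdeleRing.coe_ideleBaseChange, AdeleRing.baseChange_snd, posRealIdele_snd, posRealIdele_snd,
      map_one]

/-- **`N_{E/F}(z_E(t)) = z_F(t ^ [E : F])`** for the positive real ideles. [folklore] -/
theorem AdeleRing.ideleRelNorm_posRealIdele (t : NNRealˣ) :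
    AdeleRing.ideleRelNorm F E (posRealIdele E t) = posRealIdele F (t ^ Fintype.card (E ≃ₐ[F] E)) :=
  AdeleRing.ideleRelNorm_eq_iff.2 (by
    rw [AdeleRing.ideleBaseChange_posRealIdele, ideleGalNorm_posRealIdele])

/-- **The norm of a local idele above `v`** (idelic form of `N_{E_w/F_v}(u) = u^{e f}` for
`u ∈ F_vˣ`): for `w₀ ∣ v` and the local idele `⟨u⟩_{w₀}` of `E` (`u` viewed in `E_{w₀}`),
`N_{E/F}(⟨u⟩_{w₀}) = ⟨u⟩_v ^ (e_v f_v)` (`ideleGalNorm_localUnits`).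
[cite: CasselsFrohlichANT1967, Ch. VII §1.2] -/
theorem AdeleRing.ideleRelNorm_localUnits (v : HeightOneSpectrum (𝓞 F)) (u : (v.adicCompletion F)ˣ)
    (c : ∀ w : HeightOneSpectrum (𝓞 E), (w.adicCompletion E)ˣ)
    (hc : ∀ (w : HeightOneSpectrum (𝓞 E)) (_ : w.under (𝓞 F) = v) [w.asIdeal.LiesOver v.asIdeal],
      (c w : w.adicCompletion E) = adicCompletionOfLiesOver F E v w (u : v.adicCompletion F))
    {w₀ : HeightOneSpectrum (𝓞 E)} (hw₀ : w₀.under (𝓞 F) = v) :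
    AdeleRing.ideleRelNorm F E (GaloisRepresentations.localUnits w₀ (c w₀)) =
      GaloisRepresentations.localUnits v u ^
        (v.asIdeal.ramificationIdxIn (𝓞 E) * v.asIdeal.inertiaDegIn (𝓞 E)) :=
  AdeleRing.ideleRelNorm_eq_iff.2 (by rw [map_pow, ideleGalNorm_localUnits E v u c hc hw₀])

end RelNorm

end Literature.NumberTheory.Automorphic
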